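import Literature.InformationTheory.QuantumCodes.BivariateBicycleCodesSection5
import Literature.InformationTheory.QuantumCodes.TwoBlockConnectedComponents
import Literature.InformationTheory.QuantumCodes.TwoBlockToricLayout
import Literature.InformationTheory.QuantumCodes.TwoBlockWheelComponents
import Mathlib.Data.ZMod.Basic
import HarnessLib
import HarnessLib.Audit.Tags

/-!
# Bravyi et al. 2024, §4 after Lemma 4 — the two "interesting cases" AS PRINTED, in the kernel:
# `QC(x²⁶+y⁶+y⁸, y⁷+x⁹+x²⁰)` on `ℤ₂₈ × ℤ₁₄` (`[[784,24,≤24]]`) is connected but meets NO instance of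
# Lemma 4's hypothesis; `QC(x+y¹¹+y³, y²+x¹⁵+x)` on `ℤ₁₈ × ℤ₁₂` (`[[432,4,≤22]]`) meets it ONLY with
# `(μ, λ) = (36, 6)`

Source (read on the page): S. Bravyi, A. W. Cross, J. M. Gambetta, D. Maslov, P. Rall, T. J. Yoder, Nature **627**
(2024) 778 = arXiv:2308.07915 [BravyiEtAl2024], §4, the paragraph after the proof of Lemma 4 (held text chunk p0011
L41–48): "there are codes with connected Tanner graphs that do not satisfy the conditions for a toric layout given
in Lemma 4. One example of such a code is `QC(A,B)` with `ℓ,m = 28,14`, `A = x²⁶+y⁶+y⁸`, and `B = y⁷+x⁹+x²⁰` which has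
parameters `[[784,24,≤24]]`. Second, for a code satisfying the conditions of Lemma 4, it need not be the case that
the set `{ord(A_iA_jᵀ), ord(B_gB_hᵀ)}` and the set `{ℓ,m}` are equal. For example, the `[[432,4,≤22]]` code with
`ℓ,m = 18,12` and `A = x+y¹¹+y³`, `B = y²+x¹⁵+x` only satisfies Lemma 4 with `μ,λ = 36,6` (take `i=g=1` and `j=h=2` for
instance)."  Lemma 4 (p0011 L28–30): "A code `QC(A,B)` has a toric layout if there exist `i,j,g,h ∈ {1,2,3}` such that
(i) `⟨A_iA_jᵀ, B_gB_hᵀ⟩ = M` and (ii) `ord(A_iA_jᵀ) ord(B_gB_hᵀ) = ℓm`."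

The two codes are the typed DATA `BB.bb784`, `BB.bb432` of `BivariateBicycleCodesSection5.lean` (qec-search-2 g4; their
printed parameters are CLAIMS there and are NOT used here). In the tree's additive rendering
(`TwoBlockToricLayout.lean`: `A_iA_jᵀ ↦ g − g'` for exponents `g, g'` of `A`; `ord ↦ addOrderOf`;
`⟨·,·⟩ = M ↦ AddSubgroup.closure {g − g', h − h'} = ⊤`) this file PROVES, at tier KERNEL (axioms standard, no
`native_decide`):

* `bb784_tannerGraph_connected` — Lemma 3 (`x = 5•(x⁹ − x²⁰)`-type multiples, `decide`d);
* `bb784_closure_ne_top` — for ALL exponents `g, g'` of `A` and `h, h'` of `B` (81 ordered choices),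
  `⟨g − g', h − h'⟩ ≠ ℤ₂₈ × ℤ₁₄`: every such pair lies in the kernel of one of the three parity characters
  `ℤ₂₈ × ℤ₁₄ →+ ℤ₂` (`(a,b) ↦ a`, `↦ b`, `↦ a + b (mod 2)`; indeed every exponent of `A` has both coordinates even) —
  hence `bb784_no_lemma4_witness`: condition (i) of Lemma 4 fails for every `i, j, g, h`, so the lemma's hypothesis
  `(i) ∧ (ii)` is never met — the printed "do not satisfy the conditions … given in Lemma 4", as printed. HONEST
  FRAMING: this is a statement about Lemma 4's SUFFICIENT condition; it does NOT assert that `bb784` has no toric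
  layout (Definition 1) — the paper does not claim that either;
* `bb432_tannerGraph_connected`, `bb432_hasToricLayoutWith : HasToricLayoutWith 36 6 …` (Lemma 4 with the printed
  witness `i=g=1`, `j=h=2`: `x − y¹¹ ↦ (1,1)` of order 36, `y² − x¹⁵ ↦ (3,2)` of order 6, generating), and
  `bb432_lemma4_orders_eq` — for ALL `g, g', h, h'` in the supports, (i) and (ii) together force
  `(addOrderOf (g − g'), addOrderOf (h − h')) = (36, 6)`: the printed "only satisfies Lemma 4 with `μ,λ = 36,6`";
* `bb784_wheel_layers`, `bb432_wheel_layers` — Lemma 2 minus planarity (`BB.Code.exists_wheel_layers`): wheel graphs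
  `prismGraph 14`/`prismGraph 56` and `prismGraph 6`/`prismGraph 12`.

Method: support enumeration by `decide`, then a finite case split; non-generation by explicit characters
(`closure_ne_top_of_map_eq_zero`); orders by `addOrderOf_eq_iff` + `decide`. Companion of `Census/BB/Layout.lean`
(qec-type-05 gen 3: the seven Table-3 codes) and `Layout756.lean` (gen 4).
-/

namespace Summit.Ventures.QEC.Census.BBLayoutSection4

open Literature.InformationTheory.QuantumCodes AddSubgroup

/-! ## A non-generation certificate: two elements in the kernel of a character with a non-trivial value -/

/-- If an additive character `φ` kills `d₁` and `d₂` but not `e`, then `d₁, d₂` do not generate the group.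
(Elementary; the certificate shape used below.) -/
theorem closure_ne_top_of_map_eq_zero {G H : Type*} [AddCommGroup G] [AddCommGroup H] (φ : G →+ H)
    {d₁ d₂ e : G} (h₁ : φ d₁ = 0) (h₂ : φ d₂ = 0) (he : φ e ≠ 0) :
    AddSubgroup.closure ({d₁, d₂} : Set G) ≠ ⊤ := by
  intro htop
  have hle : AddSubgroup.closure ({d₁, d₂} : Set G) ≤ φ.ker := by
    rw [AddSubgroup.closure_le]
    intro x hx
    rcases hx with rfl | rfl
    · exact h₁
    · exact h₂
  exact he (hle (htop ▸ AddSubgroup.mem_top e))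

/-! ## `[[784,24,≤24]]`: `QC(x²⁶+y⁶+y⁸, y⁷+x⁹+x²⁰)` on `ℤ₂₈ × ℤ₁₄` -/

section BB784

/-- Parity of the first coordinate, `ℤ₂₈ × ℤ₁₄ →+ ℤ₂`. (definition) -/
def χ₁ : BB.Mono 28 14 →+ ZMod 2 :=
  (ZMod.castHom (show 2 ∣ 28 by norm_num) (ZMod 2)).toAddMonoidHom.comp (AddMonoidHom.fst (ZMod 28) (ZMod 14))

/-- Parity of the second coordinate. (definition) -/
def χ₂ : BB.Mono 28 14 →+ ZMod 2 :=
  (ZMod.castHom (show 2 ∣ 14 by norm_num) (ZMod 2)).toAddMonoidHom.comp (AddMonoidHom.snd (ZMod 28) (ZMod 14))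

/-- Parity of the coordinate sum. (definition) -/
def χ₃ : BB.Mono 28 14 →+ ZMod 2 := χ₁ + χ₂

set_option maxRecDepth 100000 in
/-- The exponents of `A = x²⁶ + y⁶ + y⁸` and of `B = y⁷ + x⁹ + x²⁰` (support enumeration, `decide`). -/
theorem bb784_support :
    (∀ g : BB.Mono 28 14, BB.bb784.A g ≠ 0 ↔ g = ((26 : Fin 28), (0 : Fin 14)) ∨ g = ((0 : Fin 28), (6 : Fin 14)) ∨
        g = ((0 : Fin 28), (8 : Fin 14))) ∧
    (∀ g : BB.Mono 28 14, BB.bb784.B g ≠ 0 ↔ g = ((0 : Fin 28), (7 : Fin 14)) ∨ g = ((9 : Fin 28), (0 : Fin 14)) ∨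
        g = ((20 : Fin 28), (0 : Fin 14))) := by
  refine ⟨by decide +kernel, by decide +kernel⟩

set_option maxRecDepth 100000 in
/-- **The Tanner graph of `bb784` is connected** (Lemma 3: `x = 5•((9,0) − (20,0))`,
`y = 8•((26,0) − (0,6)) + 9•((0,7) − (20,0))` are explicit exponent-difference combinations; `decide`d).
"codes with connected Tanner graphs", as printed. [cite: BravyiEtAl2024, §4 after Lemma 4 (arXiv:2308.07915 chunk p0011 L41–47)] -/
theorem bb784_tannerGraph_connected : BB.bb784.css.tannerGraph.Connected := by
  refine BB.bb784.tannerGraph_connected_of_unit_mem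
    (fun h => absurd (congrFun h ((26 : Fin 28), (0 : Fin 14))) (by decide))
    (fun h => absurd (congrFun h ((0 : Fin 28), (7 : Fin 14))) (by decide)) ?_ ?_
  · have e : (((1 : Fin 28), (0 : Fin 14)) : BB.Mono 28 14) = (5 : ℕ) • ((((9 : Fin 28), (0 : Fin 14))) - (20, 0)) := by
      decide
    rw [e]
    exact AddSubgroup.nsmul_mem _ (BB.bb784.sub_mem_expDiffSubgroup_B (by decide) (by decide)) 5
  · have e : (((0 : Fin 28), (1 : Fin 14)) : BB.Mono 28 14) =
        (8 : ℕ) • ((((26 : Fin 28), (0 : Fin 14))) - (0, 6)) + (9 : ℕ) • ((((0 : Fin 28), (7 : Fin 14))) - (20, 0)) := by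
      decide
    rw [e]
    exact AddSubgroup.add_mem _
      (AddSubgroup.nsmul_mem _ (BB.bb784.sub_mem_expDiffSubgroup_A (by decide) (by decide)) 8)
      (AddSubgroup.nsmul_mem _ (BB.bb784.sub_mem_expDiffSubgroup_B (by decide) (by decide)) 9)

set_option maxRecDepth 100000 in
/-- **Condition (i) of Lemma 4 fails for every choice of `i, j, g, h`** on `bb784`: for all exponents `g, g'` of `A`
and `h, h'` of `B`, `⟨g − g', h − h'⟩ ≠ ℤ₂₈ × ℤ₁₄` — each pair lies in the kernel of one of the parity characters
`χ₁, χ₂, χ₃` (all exponents of `A` are doubles, so `g − g' ∈ 2M` always). KERNEL (81 cases, `decide`).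
[cite: BravyiEtAl2024, §4 after Lemma 4 (arXiv:2308.07915 chunk p0011 L41–47)] -/
theorem bb784_closure_ne_top (g g' h h' : BB.Mono 28 14) (hg : BB.bb784.A g ≠ 0) (hg' : BB.bb784.A g' ≠ 0)
    (hh : BB.bb784.B h ≠ 0) (hh' : BB.bb784.B h' ≠ 0) :
    AddSubgroup.closure ({g - g', h - h'} : Set (BB.Mono 28 14)) ≠ ⊤ := by
  obtain ⟨hA, hB⟩ := bb784_support
  rcases (hA g).1 hg with rfl | rfl | rfl <;> rcases (hA g').1 hg' with rfl | rfl | rfl <;>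
    rcases (hB h).1 hh with rfl | rfl | rfl <;> rcases (hB h').1 hh' with rfl | rfl | rfl
  all_goals
    first
    | exact closure_ne_top_of_map_eq_zero χ₁ (by decide) (by decide) (e := ((1 : Fin 28), (0 : Fin 14))) (by decide)
    | exact closure_ne_top_of_map_eq_zero χ₂ (by decide) (by decide) (e := ((0 : Fin 28), (1 : Fin 14))) (by decide)
    | exact closure_ne_top_of_map_eq_zero χ₃ (by decide) (by decide) (e := ((1 : Fin 28), (0 : Fin 14))) (by decide)

/-- **`bb784` meets NO instance of Lemma 4's hypothesis** ("do not satisfy the conditions for a toric layout given in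
Lemma 4", AS PRINTED): there are no exponents `g, g'` of `A` and `h, h'` of `B` with `⟨g − g', h − h'⟩ = ℤ₂₈ × ℤ₁₄` and
`ord(g − g')·ord(h − h') = 28·14`. (This concerns the lemma's SUFFICIENT condition only; no claim about Definition 1.)
[cite: BravyiEtAl2024, Lemma 4 + §4 after it (arXiv:2308.07915 chunk p0011 L28–47)] -/
theorem bb784_no_lemma4_witness :
    ¬ ∃ g g' h h' : BB.Mono 28 14, BB.bb784.A g ≠ 0 ∧ BB.bb784.A g' ≠ 0 ∧ BB.bb784.B h ≠ 0 ∧ BB.bb784.B h' ≠ 0 ∧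
      AddSubgroup.closure ({g - g', h - h'} : Set (BB.Mono 28 14)) = ⊤ ∧
      addOrderOf (g - g') * addOrderOf (h - h') = 28 * 14 := by
  rintro ⟨g, g', h, h', hg, hg', hh, hh', htop, -⟩
  exact bb784_closure_ne_top g g' h h' hg hg' hh hh' htop

set_option maxRecDepth 100000 in
/-- **`bb784`**: Tanner graph = edge-disjoint union of two layers whose components are wheel graphs `prismGraph 14`
(`A₃A₂ᵀ ↦ (0,8) − (0,6)` of order 7) and `prismGraph 56` (`B₂B₁ᵀ ↦ (9,0) − (0,7)` of order 28) — Lemma 2 minus planarity.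
[cite: BravyiEtAl2024, Lemma 2 (arXiv:2308.07915 chunk p0010 L49)] -/
theorem bb784_wheel_layers :
    ∃ ΓA ΓB : SimpleGraph ((BB.Mono 28 14 ⊕ BB.Mono 28 14) ⊕ (BB.Mono 28 14 ⊕ BB.Mono 28 14)),
    BB.bb784.css.tannerGraph = ΓA ⊔ ΓB ∧ Disjoint ΓA ΓB ∧
    (∀ K : ΓA.ConnectedComponent, Nonempty (K.toSimpleGraph ≃g prismGraph 14)) ∧
    (∀ K : ΓB.ConnectedComponent, Nonempty (K.toSimpleGraph ≃g prismGraph 56)) := by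
  obtain ⟨hA, hB⟩ := bb784_support
  have h := BB.bb784.exists_wheel_layers (g₁ := ((26 : Fin 28), (0 : Fin 14))) (g₂ := ((0 : Fin 28), (6 : Fin 14)))
    (g₃ := ((0 : Fin 28), (8 : Fin 14))) (h₁ := ((0 : Fin 28), (7 : Fin 14))) (h₂ := ((9 : Fin 28), (0 : Fin 14)))
    (h₃ := ((20 : Fin 28), (0 : Fin 14))) (by decide) (by decide) (by decide) (by decide) (by decide) (by decide) hA hB
  have e1 : addOrderOf ((((0 : Fin 28), (8 : Fin 14)) : BB.Mono 28 14) - (0, 6)) = 7 :=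
    (addOrderOf_eq_iff (by norm_num)).mpr (by decide)
  have e2 : addOrderOf ((((9 : Fin 28), (0 : Fin 14)) : BB.Mono 28 14) - (0, 7)) = 28 :=
    (addOrderOf_eq_iff (by norm_num)).mpr (by decide)
  rw [e1, e2] at h
  exact h

end BB784

/-! ## `[[432,4,≤22]]`: `QC(x+y¹¹+y³, y²+x¹⁵+x)` on `ℤ₁₈ × ℤ₁₂` -/

section BB432

/-- Parity of the first coordinate, `ℤ₁₈ × ℤ₁₂ →+ ℤ₂`. (definition) -/
def ψ₁ : BB.Mono 18 12 →+ ZMod 2 :=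
  (ZMod.castHom (show 2 ∣ 18 by norm_num) (ZMod 2)).toAddMonoidHom.comp (AddMonoidHom.fst (ZMod 18) (ZMod 12))

/-- Parity of the second coordinate. (definition) -/
def ψ₂ : BB.Mono 18 12 →+ ZMod 2 :=
  (ZMod.castHom (show 2 ∣ 12 by norm_num) (ZMod 2)).toAddMonoidHom.comp (AddMonoidHom.snd (ZMod 18) (ZMod 12))

/-- Parity of the coordinate sum. (definition) -/
def ψ₃ : BB.Mono 18 12 →+ ZMod 2 := ψ₁ + ψ₂

/-- The character `(a, b) ↦ a + 2b (mod 3)`. (definition) -/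
def ψ₄ : BB.Mono 18 12 →+ ZMod 3 :=
  (ZMod.castHom (show 3 ∣ 18 by norm_num) (ZMod 3)).toAddMonoidHom.comp (AddMonoidHom.fst (ZMod 18) (ZMod 12)) +
  2 • (ZMod.castHom (show 3 ∣ 12 by norm_num) (ZMod 3)).toAddMonoidHom.comp (AddMonoidHom.snd (ZMod 18) (ZMod 12))

set_option maxRecDepth 100000 in
/-- The exponents of `A = x + y¹¹ + y³` and of `B = y² + x¹⁵ + x` (support enumeration, `decide`). -/
theorem bb432_support :
    (∀ g : BB.Mono 18 12, BB.bb432.A g ≠ 0 ↔ g = ((1 : Fin 18), (0 : Fin 12)) ∨ g = ((0 : Fin 18), (11 : Fin 12)) ∨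
        g = ((0 : Fin 18), (3 : Fin 12))) ∧
    (∀ g : BB.Mono 18 12, BB.bb432.B g ≠ 0 ↔ g = ((0 : Fin 18), (2 : Fin 12)) ∨ g = ((15 : Fin 18), (0 : Fin 12)) ∨
        g = ((1 : Fin 18), (0 : Fin 12))) := by
  refine ⟨by decide +kernel, by decide +kernel⟩

set_option maxRecDepth 100000 in
/-- **The Tanner graph of `bb432` is connected** (Lemma 3: `x = 34•((1,0) − (0,11)) + ((0,2) − (15,0))`,
`y = 3•((1,0) − (0,11)) + 5•((0,2) − (15,0))`; `decide`d). [cite: BravyiEtAl2024, Lemma 3 (arXiv:2308.07915 chunk p0011 L9)] -/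
theorem bb432_tannerGraph_connected : BB.bb432.css.tannerGraph.Connected := by
  refine BB.bb432.tannerGraph_connected_of_unit_mem
    (fun h => absurd (congrFun h ((1 : Fin 18), (0 : Fin 12))) (by decide))
    (fun h => absurd (congrFun h ((0 : Fin 18), (2 : Fin 12))) (by decide)) ?_ ?_
  · have e : (((1 : Fin 18), (0 : Fin 12)) : BB.Mono 18 12) =
        (34 : ℕ) • ((((1 : Fin 18), (0 : Fin 12))) - (0, 11)) + (1 : ℕ) • ((((0 : Fin 18), (2 : Fin 12))) - (15, 0)) := by
      decide
    rw [e]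
    exact AddSubgroup.add_mem _
      (AddSubgroup.nsmul_mem _ (BB.bb432.sub_mem_expDiffSubgroup_A (by decide) (by decide)) 34)
      (AddSubgroup.nsmul_mem _ (BB.bb432.sub_mem_expDiffSubgroup_B (by decide) (by decide)) 1)
  · have e : (((0 : Fin 18), (1 : Fin 12)) : BB.Mono 18 12) =
        (3 : ℕ) • ((((1 : Fin 18), (0 : Fin 12))) - (0, 11)) + (5 : ℕ) • ((((0 : Fin 18), (2 : Fin 12))) - (15, 0)) := by
      decide
    rw [e]
    exact AddSubgroup.add_mem _
      (AddSubgroup.nsmul_mem _ (BB.bb432.sub_mem_expDiffSubgroup_A (by decide) (by decide)) 3)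
      (AddSubgroup.nsmul_mem _ (BB.bb432.sub_mem_expDiffSubgroup_B (by decide) (by decide)) 5)

/-- The printed Lemma-4 generators of `bb432` (`i=g=1`, `j=h=2`): `x − y¹¹ ↦ (1,0) − (0,11) = (1,1)` and
`y² − x¹⁵ ↦ (0,2) − (15,0) = (3,2)` generate `ℤ₁₈ × ℤ₁₂`. [cite: BravyiEtAl2024, §4 after Lemma 4 "(take i=g=1 and j=h=2 for instance)" (arXiv:2308.07915 chunk p0011 L48)] -/
theorem bb432_closure_eq_top :
    AddSubgroup.closure ({(((1 : Fin 18), (0 : Fin 12)) : BB.Mono 18 12) - (0, 11),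
      (((0 : Fin 18), (2 : Fin 12)) : BB.Mono 18 12) - (15, 0)} : Set (BB.Mono 18 12)) = ⊤ := by
  apply BB.Code.addSubgroup_eq_top_of_unit_mem
  · have h1 := AddSubgroup.subset_closure (k := ({(((1 : Fin 18), (0 : Fin 12)) : BB.Mono 18 12) - (0, 11),
      (((0 : Fin 18), (2 : Fin 12)) : BB.Mono 18 12) - (15, 0)} : Set (BB.Mono 18 12))) (Set.mem_insert _ _)
    have h2 := AddSubgroup.subset_closure (k := ({(((1 : Fin 18), (0 : Fin 12)) : BB.Mono 18 12) - (0, 11),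
      (((0 : Fin 18), (2 : Fin 12)) : BB.Mono 18 12) - (15, 0)} : Set (BB.Mono 18 12))) (Set.mem_insert_of_mem _ rfl)
    have e : (34 : ℕ) • ((((1 : Fin 18), (0 : Fin 12)) : BB.Mono 18 12) - (0, 11)) +
        (1 : ℕ) • ((((0 : Fin 18), (2 : Fin 12)) : BB.Mono 18 12) - (15, 0)) = (1, 0) := by decide
    have h' := AddSubgroup.add_mem _ (AddSubgroup.nsmul_mem _ h1 34) (AddSubgroup.nsmul_mem _ h2 1)
    rw [e] at h'
    exact h'
  · have h1 := AddSubgroup.subset_closure (k := ({(((1 : Fin 18), (0 : Fin 12)) : BB.Mono 18 12) - (0, 11),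
      (((0 : Fin 18), (2 : Fin 12)) : BB.Mono 18 12) - (15, 0)} : Set (BB.Mono 18 12))) (Set.mem_insert _ _)
    have h2 := AddSubgroup.subset_closure (k := ({(((1 : Fin 18), (0 : Fin 12)) : BB.Mono 18 12) - (0, 11),
      (((0 : Fin 18), (2 : Fin 12)) : BB.Mono 18 12) - (15, 0)} : Set (BB.Mono 18 12))) (Set.mem_insert_of_mem _ rfl)
    have e : (3 : ℕ) • ((((1 : Fin 18), (0 : Fin 12)) : BB.Mono 18 12) - (0, 11)) +
        (5 : ℕ) • ((((0 : Fin 18), (2 : Fin 12)) : BB.Mono 18 12) - (15, 0)) = (0, 1) := by decide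
    have h' := AddSubgroup.add_mem _ (AddSubgroup.nsmul_mem _ h1 3) (AddSubgroup.nsmul_mem _ h2 5)
    rw [e] at h'
    exact h'

set_option maxRecDepth 100000 in
/-- The printed generators have orders `36` and `6` (`36 · 6 = 216 = ℓm`). -/
theorem bb432_orders : addOrderOf ((((1 : Fin 18), (0 : Fin 12)) : BB.Mono 18 12) - (0, 11)) = 36 ∧
    addOrderOf ((((0 : Fin 18), (2 : Fin 12)) : BB.Mono 18 12) - (15, 0)) = 6 :=
  ⟨(addOrderOf_eq_iff (by norm_num)).mpr (by decide), (addOrderOf_eq_iff (by norm_num)).mpr (by decide)⟩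

/-- **`bb432` has a toric layout with `(μ, λ) = (36, 6)`** (Lemma 4 with the printed witness `i=g=1`, `j=h=2`).
[cite: BravyiEtAl2024, §4 after Lemma 4 (arXiv:2308.07915 chunk p0011 L48)] -/
theorem bb432_hasToricLayoutWith : HasToricLayoutWith 36 6 BB.bb432.css.tannerGraph := by
  have h := BB.bb432.hasToricLayoutWith_of_exponents (g := ((1 : Fin 18), (0 : Fin 12))) (g' := (0, 11))
    (h := ((0 : Fin 18), (2 : Fin 12))) (h' := (15, 0)) (by decide) (by decide) (by decide) (by decide)
    bb432_closure_eq_top (by rw [bb432_orders.1, bb432_orders.2])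
  rwa [bb432_orders.1, bb432_orders.2] at h

/-- `bb432` has a toric layout (Definition 1). -/
theorem bb432_hasToricLayout : HasToricLayout BB.bb432.css.tannerGraph :=
  ⟨36, 6, by norm_num, by norm_num, bb432_hasToricLayoutWith⟩

set_option maxRecDepth 100000 in
/-- The four exponent differences inside `A` of order `36`: `±((1,0) − (0,11))`, `±((1,0) − (0,3))`. -/
theorem bb432_o36 :
    addOrderOf ((((1 : Fin 18), (0 : Fin 12)) : BB.Mono 18 12) - ((0 : Fin 18), (11 : Fin 12))) = 36 ∧
    addOrderOf ((((1 : Fin 18), (0 : Fin 12)) : BB.Mono 18 12) - ((0 : Fin 18), (3 : Fin 12))) = 36 ∧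
    addOrderOf ((((0 : Fin 18), (11 : Fin 12)) : BB.Mono 18 12) - ((1 : Fin 18), (0 : Fin 12))) = 36 ∧
    addOrderOf ((((0 : Fin 18), (3 : Fin 12)) : BB.Mono 18 12) - ((1 : Fin 18), (0 : Fin 12))) = 36 :=
  ⟨(addOrderOf_eq_iff (by norm_num)).mpr (by decide), (addOrderOf_eq_iff (by norm_num)).mpr (by decide),
    (addOrderOf_eq_iff (by norm_num)).mpr (by decide), (addOrderOf_eq_iff (by norm_num)).mpr (by decide)⟩

set_option maxRecDepth 100000 in
/-- The two exponent differences inside `B` of order `18`: `±((0,2) − (1,0))`. -/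
theorem bb432_o18 :
    addOrderOf ((((0 : Fin 18), (2 : Fin 12)) : BB.Mono 18 12) - ((1 : Fin 18), (0 : Fin 12))) = 18 ∧
    addOrderOf ((((1 : Fin 18), (0 : Fin 12)) : BB.Mono 18 12) - ((0 : Fin 18), (2 : Fin 12))) = 18 :=
  ⟨(addOrderOf_eq_iff (by norm_num)).mpr (by decide), (addOrderOf_eq_iff (by norm_num)).mpr (by decide)⟩

set_option maxRecDepth 100000 in
/-- **"only satisfies Lemma 4 with `μ, λ = 36, 6`"**, AS PRINTED: for ALL exponents `g, g'` of `A` and `h, h'` of `B`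
of `bb432`, if `⟨g − g', h − h'⟩ = ℤ₁₈ × ℤ₁₂` and `ord(g − g')·ord(h − h') = 18·12`, then `ord(g − g') = 36` and
`ord(h − h') = 6`. KERNEL (81 cases: non-generating pairs refuted by the characters `ψ₁…ψ₄`, generating pairs have
orders `(36, 6)` or `(36, 18)`, the latter excluded by (ii)).
[cite: BravyiEtAl2024, §4 after Lemma 4 (arXiv:2308.07915 chunk p0011 L48)] -/
theorem bb432_lemma4_orders_eq (g g' h h' : BB.Mono 18 12) (hg : BB.bb432.A g ≠ 0) (hg' : BB.bb432.A g' ≠ 0)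
    (hh : BB.bb432.B h ≠ 0) (hh' : BB.bb432.B h' ≠ 0)
    (hgen : AddSubgroup.closure ({g - g', h - h'} : Set (BB.Mono 18 12)) = ⊤)
    (hord : addOrderOf (g - g') * addOrderOf (h - h') = 18 * 12) :
    addOrderOf (g - g') = 36 ∧ addOrderOf (h - h') = 6 := by
  obtain ⟨hA, hB⟩ := bb432_support
  rcases (hA g).1 hg with rfl | rfl | rfl <;> rcases (hA g').1 hg' with rfl | rfl | rfl <;>
    rcases (hB h).1 hh with rfl | rfl | rfl <;> rcases (hB h').1 hh' with rfl | rfl | rfl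
  all_goals
    first
    | exact absurd hgen (closure_ne_top_of_map_eq_zero ψ₁ (by decide) (by decide) (e := ((1 : Fin 18), (0 : Fin 12))) (by decide))
    | exact absurd hgen (closure_ne_top_of_map_eq_zero ψ₂ (by decide) (by decide) (e := ((0 : Fin 18), (1 : Fin 12))) (by decide))
    | exact absurd hgen (closure_ne_top_of_map_eq_zero ψ₃ (by decide) (by decide) (e := ((1 : Fin 18), (0 : Fin 12))) (by decide))
    | exact absurd hgen (closure_ne_top_of_map_eq_zero ψ₄ (by decide) (by decide) (e := ((1 : Fin 18), (0 : Fin 12))) (by decide))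
    | exact ⟨(addOrderOf_eq_iff (by norm_num)).mpr (by decide), (addOrderOf_eq_iff (by norm_num)).mpr (by decide)⟩
    | (exfalso
       first
         | rw [bb432_o36.1] at hord
         | rw [bb432_o36.2.1] at hord
         | rw [bb432_o36.2.2.1] at hord
         | rw [bb432_o36.2.2.2] at hord
       first
         | rw [bb432_o18.1] at hord
         | rw [bb432_o18.2] at hord
       norm_num at hord)

set_option maxRecDepth 100000 in
/-- **`bb432`**: Tanner graph = edge-disjoint union of two layers of wheel graphs `prismGraph 6` (`A₃A₂ᵀ ↦ (0,3) − (0,11)`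
of order 3) and `prismGraph 12` (`B₂B₁ᵀ ↦ (15,0) − (0,2)` of order 6) — Lemma 2 minus planarity.
[cite: BravyiEtAl2024, Lemma 2 (arXiv:2308.07915 chunk p0010 L49)] -/
theorem bb432_wheel_layers :
    ∃ ΓA ΓB : SimpleGraph ((BB.Mono 18 12 ⊕ BB.Mono 18 12) ⊕ (BB.Mono 18 12 ⊕ BB.Mono 18 12)),
    BB.bb432.css.tannerGraph = ΓA ⊔ ΓB ∧ Disjoint ΓA ΓB ∧
    (∀ K : ΓA.ConnectedComponent, Nonempty (K.toSimpleGraph ≃g prismGraph 6)) ∧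
    (∀ K : ΓB.ConnectedComponent, Nonempty (K.toSimpleGraph ≃g prismGraph 12)) := by
  obtain ⟨hA, hB⟩ := bb432_support
  have h := BB.bb432.exists_wheel_layers (g₁ := ((1 : Fin 18), (0 : Fin 12))) (g₂ := ((0 : Fin 18), (11 : Fin 12)))
    (g₃ := ((0 : Fin 18), (3 : Fin 12))) (h₁ := ((0 : Fin 18), (2 : Fin 12))) (h₂ := ((15 : Fin 18), (0 : Fin 12)))
    (h₃ := ((1 : Fin 18), (0 : Fin 12))) (by decide) (by decide) (by decide) (by decide) (by decide) (by decide) hA hB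
  have e1 : addOrderOf ((((0 : Fin 18), (3 : Fin 12)) : BB.Mono 18 12) - (0, 11)) = 3 :=
    (addOrderOf_eq_iff (by norm_num)).mpr (by decide)
  have e2 : addOrderOf ((((15 : Fin 18), (0 : Fin 12)) : BB.Mono 18 12) - (0, 2)) = 6 :=
    (addOrderOf_eq_iff (by norm_num)).mpr (by decide)
  rw [e1, e2] at h
  exact h

end BB432

end Summit.Ventures.QEC.Census.BBLayoutSection4
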